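import Summits.KontsevichZagierPeriods.KontsevichZagierPeriods.Theses.UnfoldedStokes
import Summits.KontsevichZagierPeriods.KontsevichZagierPeriods.Theorems.UnfoldedStokesUnfoldedStokesSquare
import Literature.NumberTheory.Transcendental.KZKernelConjectureForms
import Literature.NumberTheory.Transcendental.KZCalculusProofs
import Literature.NumberTheory.Transcendental.KZCubicalCalculus
import Summits.KontsevichZagierPeriods.KontsevichZagierPeriods.Theorems.CompleteModGammaSector.Negative.ChangeOfVariables
import Summits.KontsevichZagierPeriods.KontsevichZagierPeriods.Theorems.CompleteModGammaSector.Negative.DomainAdditivity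
import Summits.KontsevichZagierPeriods.KontsevichZagierPeriods.Theorems.StuffleInKZ.Negative.IntegrandAdditivityDerived

/-!
# Disproof of `StokesGeneration` (stmt-KontsevichZagierPeriods-3586) — findings

Standing disprover's work file (cdisprove, cycle 1). Prose only in docstrings; every claim below is
kernel-checked unless marked `sorry` (near-misses, §E).

**Verdict so far: NO KILL, and none is cheap.** The crux is *exactly* the summit:
`stokesGeneration_iff_summit : StokesGeneration ↔ KontsevichZagierPeriods` (§0, sorry-free, using the
landed `unfoldedStokesSquare_proof` and the tree's `kzKernelConjecture_iff_isRational`). So any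
refutation of the crux is a refutation of the formalised Kontsevich–Zagier period conjecture, and
conversely; the GPC-strength barriers `kzConjecture_implies_*` apply verbatim.

## Findings (index)

* §0 CALIBRATION — `stokesGeneration_iff_kernel`, `stokesGeneration_iff_summit`,
  `sup_closure_stokesSquareRel_eq_relations` (the `⊔ closure S` summand is redundant: `S ⊆ relations`).
  LANDED p102769 ACCEPTED (Negative/IffSummit: also `not_stokesGeneration_iff_not_summit`).
* §A LOAD-BEARING ANALYSIS — the crux has one hypothesis (`eval x = 0`) and one structural datum (the
  target subgroup `relations ⊔ closure S`, `relations` generated by FOUR move sets). COMPLETE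
  PICTURE of the generator list (cycle 1):
  - `stokesGeneration_false_without_evalZero` : the target subgroup is proper (`[pt, 1] ∉ …`), i.e. the
    calculus is consistent — any proof must use `eval x = 0`. LANDED p102769 ACCEPTED (Negative/IffSummit).
  - rule (3) Newton–Leibniz: LOAD-BEARING, unconditional — `stokesGeneration_false_without_NL` (the
    invariant `dimZeroValue`, value of the dimension-0 part, kills rules (1a), (1b), (2) and every
    square relator but is `−1` on `[[0,1],1] − [pt,1]`); `newtonLeibniz_loadBearing` for the kernel
    conjecture. LANDED p100569 ACCEPTED (Negative/NewtonLeibnizLoadBearing).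
  - rule (2) change of variables: LOAD-BEARING, unconditional — `stokesGeneration_false_without_cov`
    (§A.4; tree invariant subgroup `covKer` of CompleteModGammaSectorNegative — first-coordinate
    distribution function ℝ-semialgebraic on the window [2,3] — contains rules (1a), (1b), (3) AND
    every square relator (`closure_stokesSquareRel_le_covKer`, new); witness the translation pair
    `[[0,1],1/(2−t)] − [[2,3],1/(4−t)]`, value log 2). LANDED p106484 ACCEPTED (Negative/CovDomainAddLoadBearing).
  - rule (1a) domain additivity: LOAD-BEARING modulo the named fact `Dries1998_ch4_prop_2_4`
    (invariance of the o-minimal Euler characteristic under injective definable maps) —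
    `stokesGeneration_false_without_domainAdd hE` (§A.5; tree invariant `evenEulerEval`; the square
    relators are killed UNCONDITIONALLY since `E((0,1)^k) = (−1)^k` is odd; Euler witness
    `[[0,1]∪[2,3],1] − [[0,2],1]`). LANDED p106484 ACCEPTED.
  - rule (1b) integrand additivity: REDUNDANT — `integrandAddRel ⊆ closure (domainAddRel ∪
    newtonLeibnizRel)`. ALREADY IN THE TREE (found by the reviewer of this seat's duplicate p111298):
    `StuffleInKZ.Negative.Derived.integrandAddRel_subset_closure_domAdd_nl` and
    `relations_eq_closure_three_rules` (Theorems/StuffleInKZ/Negative/IntegrandAdditivityDerived.lean,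
    band/gluing construction). This seat's independent smoothstep proof (band `σ × [0,2]`, primitive
    `f₁(x)(3t²−2t³) | f₁(x)+f₂(x)(3(t−1)²−2(t−1)³)`) elaborated at the gate but was WITHDRAWN as a
    duplicate (D-0014); its landed auxiliary module `Negative/IntegrandAddRedundantAux.lean` (p106009)
    is thereby ORPHANED — librarian note. §A.6 below imports the survivor:
    `stokesGeneration_iff_threeRules` — the crux is, unconditionally, three-rule generation of
    `ker eval` (LANDED as Negative/ThreeRules.lean, p112971 ACCEPTED).
  - `stokesGeneration_false_without_relations` : the square relators alone generate nothing outside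
    dimensions 2–3. LANDED p100569.
  UPSHOT for provers / route Neg: an additive invariant refuting the crux must kill exactly rules
  (1a), (2), (3) (rule (1b) is automatic); the three partial invariants in the tree (`dimZeroValue`,
  `covKer`, `evenEulerEval`/`domainEuler`) each die on exactly one rule.
* §B TIGHTNESS / STRUCTURE — `saturated_of_stokesGeneration`: the crux forces `relations` to be a PURE
  subgroup of the free group `FormalRep` (`k • x ∈ relations, k ≠ 0 ⇒ x ∈ relations`). A torsion
  element of `FormalRep ⧸ relations` would refute the crux; none is known (attack handle recorded, not
  closed).
* §C NATURAL STRENGTHENINGS refuted — "rules (1a),(1b),(2) + Stokes relators suffice", "rules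
  (1a),(1b),(3) + Stokes relators suffice", "rules (1b),(2),(3) + Stokes relators suffice (mod vdD 2.4)",
  "Stokes relators suffice" are all false (§A); "rules (1a),(2),(3) suffice" is EQUIVALENT to the crux.
* §D LINE `Sketch` (lead's picked line; card cube-type-a-generation) — see the section docstring:
  joint sufficiency is kernel-checked (the skeleton's `StokesGeneration_of` composes the seven stubs
  sorry-free); per-stub attack notes; no stub broken; `stub_typeAGeneration` is Ayoub's Conj. 1.1 =
  GPC strength (cannot be weakened to one variable: tree barrier `kernelElt_not_stokes_one_variable`).
* §E NEAR-MISSES / open handles — none sorried yet.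

WHY IT RESISTS: every additive invariant of `FormalRep` found so far that vanishes on two of the three
essential rules dies on the third: `dimZeroValue` (dies on (3)), `covKer` (dies on (2)), `evenEulerEval`
(dies on (1a)); weighted-integral invariants `∫_σ f·w` are forced constant by the chain of
Newton–Leibniz moves `dim 0 ← 1 ← 2 ← …` (paper, NOTES), and in the UNRESTRICTED calculus (arbitrary
measurable data and primitives) the kernel statement is trivially TRUE (every representation collapses
to `[pt, value]` by iterated Newton–Leibniz), so an obstruction must see the arithmetic of
semialgebraicity — i.e. be of GPC type. A kill needs either a torsion class in `FormalRep ⧸ relations`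
(§B) or a genuinely non-motivic invariant — route Neg's `NegObstructionShape` — which is the period
conjecture's negation itself.
-/

noncomputable section

set_option linter.dupNamespace false

namespace Summit.KontsevichZagierPeriods.KontsevichZagierPeriods.Cruxes.StokesGeneration.Disproof

open MeasureTheory Set
open Literature.NumberTheory.Transcendental
open Literature.NumberTheory.Transcendental.KZ
open Literature.ModelTheory.ExponentialFields (IsSemialgebraic)
open Summit.KontsevichZagierPeriods.KontsevichZagierPeriods.Theses.UnfoldedStokes
  (StokesGeneration UnfoldedStokesSquare)

/-! ## §0 Calibration: the crux is the kernel conjecture is the summit -/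

/-- The unfolded-Stokes square relator set `S` of the crux, verbatim (so that `StokesGeneration`
unfolds to `∀ x, eval x = 0 → x ∈ relations ⊔ closure stokesSquareRel` by `Iff.rfl`).
[cite: KontsevichZagier2001, §1.2 rule (3)] -/
def stokesSquareRel : Set FormalRep :=
  {d : FormalRep | ∃ (U : Set (Fin 2 → ℝ)) (a b c e : (Fin 2 → ℝ) → ℝ)
    (rB rR rT rL rW : IntegralRep 2) (rD : IntegralRep 3),
    (IsOpen U) ∧ (Set.Icc (0 : Fin 2 → ℝ) 1 ⊆ U) ∧ (∀ p ∈ U, ∀ u ∈ Set.Icc (0 : ℝ) 1, u • p ∈ U) ∧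
    (ContDiffOn ℝ 1 a U) ∧ (ContDiffOn ℝ 1 b U) ∧ (ContDiffOn ℝ 1 c U) ∧ (ContDiffOn ℝ 1 e U) ∧
    (∀ p ∈ U, fderiv ℝ a p (Pi.single 1 1) = fderiv ℝ b p (Pi.single 0 1)) ∧
    (IsSemialgebraicFunOn ℚ U a) ∧ (IsSemialgebraicFunOn ℚ U b) ∧ (IsSemialgebraicFunOn ℚ U c) ∧
    (IsSemialgebraicFunOn ℚ U e) ∧
    (IsSemialgebraicFunOn ℚ U (fun p => fderiv ℝ a p (Pi.single 0 1))) ∧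
    (IsSemialgebraicFunOn ℚ U (fun p => fderiv ℝ a p (Pi.single 1 1))) ∧
    (IsSemialgebraicFunOn ℚ U (fun p => fderiv ℝ b p (Pi.single 1 1))) ∧
    (IsSemialgebraicFunOn ℚ U (fun p => fderiv ℝ c p (Pi.single 1 1))) ∧
    (IsSemialgebraicFunOn ℚ U (fun p => fderiv ℝ e p (Pi.single 0 1))) ∧
    (rB.domain = {x | ∀ i, x i ∈ Set.Ioo (0 : ℝ) 1}) ∧
    (Set.EqOn rB.integrand (fun x => x 0 * a ![x 1 * x 0, 0] * c ![x 0, 0]) rB.domain) ∧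
    (rR.domain = {x | ∀ i, x i ∈ Set.Ioo (0 : ℝ) 1}) ∧
    (Set.EqOn rR.integrand (fun x => (a ![x 1, x 1 * x 0] + x 0 * b ![x 1, x 1 * x 0]) * e ![1, x 0])
      rR.domain) ∧
    (rT.domain = {x | ∀ i, x i ∈ Set.Ioo (0 : ℝ) 1}) ∧
    (Set.EqOn rT.integrand (fun x => (x 0 * a ![x 1 * x 0, x 1] + b ![x 1 * x 0, x 1]) * c ![x 0, 1])
      rT.domain) ∧
    (rL.domain = {x | ∀ i, x i ∈ Set.Ioo (0 : ℝ) 1}) ∧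
    (Set.EqOn rL.integrand (fun x => x 0 * b ![0, x 1 * x 0] * e ![0, x 0]) rL.domain) ∧
    (rW.domain = {x | ∀ i, x i ∈ Set.Ioo (0 : ℝ) 1}) ∧
    (Set.EqOn rW.integrand (fun x => a ![x 0, x 1] * e ![x 0, x 1] - b ![x 0, x 1] * c ![x 0, x 1])
      rW.domain) ∧
    (rD.domain = {x | ∀ i, x i ∈ Set.Ioo (0 : ℝ) 1}) ∧
    (Set.EqOn rD.integrand (fun x => (x 0 * a ![x 2 * x 0, x 2 * x 1] + x 1 * b ![x 2 * x 0, x 2 * x 1]) *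
      (fderiv ℝ e ![x 0, x 1] (Pi.single 0 1) - fderiv ℝ c ![x 0, x 1] (Pi.single 1 1))) rD.domain) ∧
    d = of rB + of rR - of rT - of rL - of rW - of rD}

/-- The crux, unfolded through `stokesSquareRel` (definitional). [cite: KontsevichZagier2001, §1.2] -/
theorem stokesGeneration_iff :
    StokesGeneration ↔
      ∀ x : FormalRep, eval x = 0 → x ∈ relations ⊔ AddSubgroup.closure stokesSquareRel :=
  Iff.rfl

/-- Part A of the route is LANDED (`unfoldedStokesSquare_proof`, stmt-3520): every square relator is a
relation of the four-move calculus. [cite: KontsevichZagier2001, §1.2 rule (3)] -/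
theorem closure_stokesSquareRel_le_relations : AddSubgroup.closure stokesSquareRel ≤ relations := by
  refine (AddSubgroup.closure_le _).mpr ?_
  rintro d ⟨U, a, b, c, e, rB, rR, rT, rL, rW, rD, hUo, hUI, hUs, ha, hb, hc, he, hcl, sa, sb, sc,
    se, sa0, sa1, sb1, sc1, se0, hBd, hBi, hRd, hRi, hTd, hTi, hLd, hLi, hWd, hWi, hDd, hDi, rfl⟩
  exact Summit.KontsevichZagierPeriods.UnfoldedStokes.UnfoldedStokesSquare.unfoldedStokesSquare_proof
    U a b c e hUo hUI hUs ha hb hc he hcl sa sb sc se sa0 sa1 sb1 sc1 se0 rB rR rT rL rW rD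
    hBd hBi hRd hRi hTd hTi hLd hLi hWd hWi hDd hDi

/-- Hence the `⊔ closure S` summand of the crux is redundant. [cite: KontsevichZagier2001, §1.2] -/
theorem sup_closure_stokesSquareRel_eq_relations :
    relations ⊔ AddSubgroup.closure stokesSquareRel = relations :=
  sup_eq_left.mpr closure_stokesSquareRel_le_relations

/-- **CALIBRATION 1.** The crux is the kernel conjecture `ker eval ≤ relations` on the nose.
[cite: KontsevichZagier2001, §1.2 Conjecture 1] -/
theorem stokesGeneration_iff_kernel : StokesGeneration ↔ KZKernelConjecture := by
  rw [stokesGeneration_iff]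
  constructor
  · intro h x hx
    have hmem := h x hx
    rwa [sup_closure_stokesSquareRel_eq_relations] at hmem
  · intro h x hx
    exact AddSubgroup.mem_sup_left (h x hx)

/-- **CALIBRATION 2.** The crux is equivalent to the SUMMIT statement `KontsevichZagierPeriods`
(Kontsevich–Zagier's Conjecture 1 over the fixed calculus). Disproving the crux = disproving the
formalised period conjecture. [cite: KontsevichZagier2001, §1.2 Conjecture 1] -/
theorem stokesGeneration_iff_summit : StokesGeneration ↔ _root_.KontsevichZagierPeriods :=
  stokesGeneration_iff_kernel.trans
    (kzKernelConjecture_iff_isRational.trans KontsevichZagierPeriods_iff.symm)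

/-! ## §A Load-bearing analysis

### A.1 The witness representations `[[0,1]ⁿ, 1]` -/

/-- The constant-one representation on the closed unit cube `[0,1]ⁿ` (value `1`; for `n = 0` this is
the point representation `[pt, 1]`). [cite: KontsevichZagier2001, §1.1] -/
def unitCubeRep (n : ℕ) : IntegralRep n :=
  IntegralRep.tameCube (fun _ => (1 : ℝ)) (fun _ _ => analyticAt_const)
    ((isSemialgebraicFunOn_natCast isSemialgebraic_cube 1).congr fun _ _ => by simp)

/-- `[[0,1]ⁿ, 1]` has value `1`. [folklore] -/
@[simp] theorem value_unitCubeRep (n : ℕ) : (unitCubeRep n).value = 1 := by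
  simp [IntegralRep.value, unitCubeRep, IntegralRep.tameCube]

/-- The kernel element `w = [[0,1]¹, 1] − [pt, 1]` (both values `1`). [folklore] -/
def witness : FormalRep := of (unitCubeRep 1) - of (unitCubeRep 0)

/-- `eval w = 0`. [folklore] -/
@[simp] theorem eval_witness : eval witness = 0 := by
  simp [witness]

/-! ### A.2 The invariant: value of the dimension-zero part -/

/-- The additive invariant `ψ : FormalRep →+ ℝ`, `[r] ↦ value r` if `r` has dimension `0`, else `0`.
It vanishes on every move that stays inside one dimension (by soundness of that move), hence on rules
(1a), (1b), (2) and on the square relators (dimensions 2, 3), but NOT on the Newton–Leibniz move from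
dimension 1 to dimension 0. [folklore] -/
def dimZeroValue : FormalRep →+ ℝ :=
  FreeAbelianGroup.lift fun r : (Σ n, IntegralRep n) => if r.1 = 0 then r.2.value else 0

/-- `ψ [r] = [n = 0] · value r`. [folklore] -/
@[simp] theorem dimZeroValue_of {n : ℕ} (r : IntegralRep n) :
    dimZeroValue (of r) = if n = 0 then r.value else 0 :=
  FreeAbelianGroup.lift_apply_of _ _

/-- `ψ w = −1 ≠ 0`. [folklore] -/
theorem dimZeroValue_witness : dimZeroValue witness = -1 := by
  simp [witness]

/-- `ψ` kills domain additivity (all three representations have the same dimension; soundness of the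
move in dimension `0`). [cite: KontsevichZagier2001, §1.2 rule (1)] -/
theorem dimZeroValue_eq_zero_of_mem_domainAddRel {c : FormalRep} (hc : c ∈ domainAddRel) :
    dimZeroValue c = 0 := by
  have h0 : eval c = 0 := eval_eq_zero_of_mem_domainAddRel_holds hc
  obtain ⟨n, r, r₁, r₂, -, -, -, -, rfl⟩ := hc
  simp only [map_sub, eval_of] at h0
  by_cases hn : n = 0
  · subst hn
    simp only [map_sub, dimZeroValue_of, if_true]
    exact h0
  · simp [hn]

/-- `ψ` kills integrand additivity. [cite: KontsevichZagier2001, §1.2 rule (1)] -/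
theorem dimZeroValue_eq_zero_of_mem_integrandAddRel {c : FormalRep} (hc : c ∈ integrandAddRel) :
    dimZeroValue c = 0 := by
  have h0 : eval c = 0 := eval_eq_zero_of_mem_integrandAddRel_holds hc
  obtain ⟨n, r, r₁, r₂, -, -, -, rfl⟩ := hc
  simp only [map_sub, eval_of] at h0
  by_cases hn : n = 0
  · subst hn
    simp only [map_sub, dimZeroValue_of, if_true]
    exact h0
  · simp [hn]

/-- `ψ` kills change of variables. [cite: KontsevichZagier2001, §1.2 rule (2)] -/
theorem dimZeroValue_eq_zero_of_mem_changeOfVariablesRel {c : FormalRep}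
    (hc : c ∈ changeOfVariablesRel) : dimZeroValue c = 0 := by
  have h0 : eval c = 0 := eval_eq_zero_of_mem_changeOfVariablesRel_holds hc
  obtain ⟨n, r, r', Φ, Φ', -, -, -, -, -, rfl⟩ := hc
  simp only [map_sub, eval_of] at h0
  by_cases hn : n = 0
  · subst hn
    simp only [map_sub, dimZeroValue_of, if_true]
    exact h0
  · simp [hn]

/-- The subgroup generated by the THREE dimension-preserving move sets (rules (1a), (1b), (2)).
[cite: KontsevichZagier2001, §1.2] -/
def threeMoves : AddSubgroup FormalRep :=
  AddSubgroup.closure (domainAddRel ∪ integrandAddRel ∪ changeOfVariablesRel)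

/-- The three dimension-preserving moves are relations. [cite: KontsevichZagier2001, §1.2] -/
theorem threeMoves_le_relations : threeMoves ≤ relations :=
  AddSubgroup.closure_mono (by intro c hc; exact Or.inl hc)

/-- `ψ` kills the three dimension-preserving moves. [folklore] -/
theorem threeMoves_le_ker : threeMoves ≤ dimZeroValue.ker := by
  refine (AddSubgroup.closure_le _).mpr ?_
  rintro c ((hc | hc) | hc) <;> simp only [SetLike.mem_coe, AddMonoidHom.mem_ker]
  · exact dimZeroValue_eq_zero_of_mem_domainAddRel hc
  · exact dimZeroValue_eq_zero_of_mem_integrandAddRel hc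
  · exact dimZeroValue_eq_zero_of_mem_changeOfVariablesRel hc

/-- `ψ` kills every square relator (all six representations live in dimensions `2` and `3`).
[folklore] -/
theorem closure_stokesSquareRel_le_ker : AddSubgroup.closure stokesSquareRel ≤ dimZeroValue.ker := by
  refine (AddSubgroup.closure_le _).mpr ?_
  rintro d ⟨U, a, b, c, e, rB, rR, rT, rL, rW, rD, -, -, -, -, -, -, -, -, -, -, -, -, -, -, -, -, -,
    -, -, -, -, -, -, -, -, -, -, -, -, rfl⟩
  simp

/-! ### A.3 The `_false_without_` theorems -/

/-- The crux WITHOUT its hypothesis `eval x = 0`: every formal combination is generated.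
[cite: KontsevichZagier2001, §1.2] -/
def StokesGenerationWithoutEvalZero : Prop :=
  ∀ x : FormalRep, x ∈ relations ⊔ AddSubgroup.closure stokesSquareRel

/-- **`eval x = 0` is load-bearing** (equivalently: the calculus is consistent, the target subgroup is
proper): `[pt, 1]` is not generated, by soundness `relations ≤ ker eval`.
[cite: KontsevichZagier2001, §1.2] -/
theorem stokesGeneration_false_without_evalZero : ¬ StokesGenerationWithoutEvalZero := by
  intro h
  have hmem := h (of (unitCubeRep 0))
  rw [sup_closure_stokesSquareRel_eq_relations] at hmem
  have h0 := relations_le_ker_eval_holds hmem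
  rw [AddMonoidHom.mem_ker, eval_of, value_unitCubeRep] at h0
  exact one_ne_zero h0

/-- The crux WITHOUT the Newton–Leibniz move among the generators of `relations` (rules (1a), (1b),
(2) kept, and the unfolded-Stokes square relators kept). [cite: KontsevichZagier2001, §1.2] -/
def StokesGenerationWithoutNL : Prop :=
  ∀ x : FormalRep, eval x = 0 → x ∈ threeMoves ⊔ AddSubgroup.closure stokesSquareRel

/-- **Rule 3) (Newton–Leibniz) is load-bearing**, even in the presence of the square relators: the
kernel element `[[0,1], 1] − [pt, 1]` has `ψ = −1`, while `ψ` kills the right-hand side. Any proof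
of the crux must use `newtonLeibnizRel` to connect dimensions. [folklore] -/
theorem stokesGeneration_false_without_NL : ¬ StokesGenerationWithoutNL := by
  intro h
  have hmem := h witness eval_witness
  have hle : threeMoves ⊔ AddSubgroup.closure stokesSquareRel ≤ dimZeroValue.ker :=
    sup_le threeMoves_le_ker closure_stokesSquareRel_le_ker
  have h0 := hle hmem
  rw [AddMonoidHom.mem_ker, dimZeroValue_witness] at h0
  norm_num at h0

/-- The crux WITHOUT `relations`: the square relators alone generate the kernel.
[cite: KontsevichZagier2001, §1.2] -/
def StokesGenerationWithoutRelations : Prop :=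
  ∀ x : FormalRep, eval x = 0 → x ∈ AddSubgroup.closure stokesSquareRel

/-- **`relations` is load-bearing**: the square relators live in dimensions `2`, `3` and cannot
generate the dimension-`0/1` kernel element `w`. [folklore] -/
theorem stokesGeneration_false_without_relations : ¬ StokesGenerationWithoutRelations := by
  intro h
  have h0 := closure_stokesSquareRel_le_ker (h witness eval_witness)
  rw [AddMonoidHom.mem_ker, dimZeroValue_witness] at h0
  norm_num at h0

/-- **Newton–Leibniz is load-bearing for the kernel conjecture itself**: the three
dimension-preserving moves do not generate `ker eval`. (Tightness of the calculus: rule 3) cannot be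
dropped from Kontsevich–Zagier's list.) [cite: KontsevichZagier2001, §1.2] -/
theorem newtonLeibniz_loadBearing : ¬ (eval.ker ≤ threeMoves) := by
  intro h
  have hw : witness ∈ eval.ker := by rw [AddMonoidHom.mem_ker]; exact eval_witness
  have h0 := threeMoves_le_ker (h hw)
  rw [AddMonoidHom.mem_ker, dimZeroValue_witness] at h0
  norm_num at h0

/-! ### A.4 Rule (2) is load-bearing (unconditional; tree invariant `covKer`) -/

section CovDomainAdd

open Summit.KontsevichZagierPeriods.CompleteModGammaSectorNegative
  (covKer mem_covKer_iff Cdf_of_eq_value WindowSemialg rulesOneThree_le_covKer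
    r₀ r₀' r₀_value_eq witness_not_mem_covKer realEuler odd_realEuler_cube evenEulerEval
    evenEulerEval_of rulesNoDomainAdd_le_ker twoIntervalsRep oneIntervalRep
    euler_witness_value_eq evenEulerEval_witness)

/-- A positive-dimensional representation whose domain lies in `{x₀ ≤ 2}` lies in `covKer` (its
first-coordinate distribution function is constant on the window `[2,3]`). [folklore] -/
theorem of_mem_covKer_of_first_le_two {n : ℕ} (hn : 0 < n) (r : IntegralRep n)
    (h : ∀ x ∈ r.domain, x ⟨0, hn⟩ ≤ 2) : of r ∈ covKer := by
  rw [mem_covKer_iff]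
  refine WindowSemialg.of_const r.value fun s hs => ?_
  exact Cdf_of_eq_value hn r (2 + s) fun x hx => (h x hx).trans (by linarith [hs.1])

/-- Every square relator lies in `covKer` (domains are open unit cubes, first coordinate `< 1`).
[folklore] -/
theorem closure_stokesSquareRel_le_covKer : AddSubgroup.closure stokesSquareRel ≤ covKer := by
  refine (AddSubgroup.closure_le _).mpr ?_
  rintro d ⟨U, a, b, c, e, rB, rR, rT, rL, rW, rD, -, -, -, -, -, -, -, -, -, -, -, -, -, -, -, -, -,
    hBd, -, hRd, -, hTd, -, hLd, -, hWd, -, hDd, -, rfl⟩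
  have h2 : ∀ r : IntegralRep 2, r.domain = {x | ∀ i, x i ∈ Set.Ioo (0 : ℝ) 1} → of r ∈ covKer :=
    fun r hr => of_mem_covKer_of_first_le_two two_pos r fun x hx => by
      rw [hr] at hx; have := (hx ⟨0, two_pos⟩).2; linarith
  have h3 : of rD ∈ covKer := of_mem_covKer_of_first_le_two three_pos rD fun x hx => by
    rw [hDd] at hx; have := (hx ⟨0, three_pos⟩).2; linarith
  exact covKer.sub_mem (covKer.sub_mem (covKer.sub_mem (covKer.sub_mem
    (covKer.add_mem (h2 rB hBd) (h2 rR hRd)) (h2 rT hTd)) (h2 rL hLd)) (h2 rW hWd)) h3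

/-- The crux WITHOUT rule (2) among the generators (rules (1a), (1b), (3) and `S` kept).
[cite: KontsevichZagier2001, §1.2] -/
def StokesGenerationWithoutCov : Prop :=
  ∀ x : FormalRep, eval x = 0 →
    x ∈ AddSubgroup.closure (domainAddRel ∪ integrandAddRel ∪ newtonLeibnizRel) ⊔
      AddSubgroup.closure stokesSquareRel

/-- **Rule (2) (change of variables) is load-bearing**, unconditionally: the translation pair
`[[0,1], 1/(2−t)] − [[2,3], 1/(4−t)]` (value `log 2` twice) is a kernel element outside `covKer`
(`1/(s−2)` has no `ℝ`-semialgebraic primitive), while `covKer` contains rules (1a), (1b), (3) and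
`S`. LANDED as `Negative/CovDomainAddLoadBearing.lean` (p106484). [cite: KontsevichZagier2001, §1.2] -/
theorem stokesGeneration_false_without_cov : ¬ StokesGenerationWithoutCov := by
  intro h
  have hw : eval (of r₀ - of r₀') = 0 := by rw [map_sub, eval_of, eval_of, r₀_value_eq, sub_self]
  exact witness_not_mem_covKer
    ((sup_le rulesOneThree_le_covKer closure_stokesSquareRel_le_covKer) (h _ hw))

/-! ### A.5 Rule (1a) is load-bearing modulo van den Dries Ch. 4 (2.4) (tree invariant `evenEulerEval`) -/

/-- Every square relator is killed by the Euler-parity-weighted evaluation, UNCONDITIONALLY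
(`E((0,1)^k) = (−1)^k` is odd). [folklore] -/
theorem closure_stokesSquareRel_le_ker_evenEulerEval :
    AddSubgroup.closure stokesSquareRel ≤ evenEulerEval.ker := by
  have hz : ∀ {k : ℕ} (r : IntegralRep k), r.domain = {x | ∀ i, x i ∈ Set.Ioo (0 : ℝ) 1} →
      evenEulerEval (of r) = 0 := fun r hr => by
    have h1 : ¬ Even (realEuler _ r.domain) := by
      rw [hr, Int.not_even_iff_odd]; exact odd_realEuler_cube _
    rw [evenEulerEval_of, if_neg h1]
  refine (AddSubgroup.closure_le _).mpr ?_
  rintro d ⟨U, a, b, c, e, rB, rR, rT, rL, rW, rD, -, -, -, -, -, -, -, -, -, -, -, -, -, -, -, -, -,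
    hBd, -, hRd, -, hTd, -, hLd, -, hWd, -, hDd, -, rfl⟩
  simp only [SetLike.mem_coe, AddMonoidHom.mem_ker, map_sub, map_add, hz rB hBd, hz rR hRd, hz rT hTd,
    hz rL hLd, hz rW hWd, hz rD hDd, add_zero, sub_zero]

/-- The crux WITHOUT rule (1a) among the generators (rules (1b), (2), (3) and `S` kept).
[cite: KontsevichZagier2001, §1.2] -/
def StokesGenerationWithoutDomainAdd : Prop :=
  ∀ x : FormalRep, eval x = 0 →
    x ∈ AddSubgroup.closure (integrandAddRel ∪ changeOfVariablesRel ∪ newtonLeibnizRel) ⊔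
      AddSubgroup.closure stokesSquareRel

/-- **Rule (1a) (domain additivity) is load-bearing modulo `Dries1998_ch4_prop_2_4`** (needed only
for the invariance of `evenEulerEval` under rule (2)): the Euler witness `[[0,1]∪[2,3], 1] − [[0,2], 1]`
has `evenEulerEval = 2`. LANDED in `Negative/CovDomainAddLoadBearing.lean` (p106484).
[cite: Dries1998, Ch. 4 (2.4)] -/
theorem stokesGeneration_false_without_domainAdd
    (hE : Literature.ModelTheory.ExponentialFields.Dries1998_ch4_prop_2_4
      Literature.ModelTheory.ExponentialFields.Language.orderedRing ℝ) :
    ¬ StokesGenerationWithoutDomainAdd := by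
  intro h
  have hw : eval (of twoIntervalsRep - of oneIntervalRep) = 0 := by
    rw [map_sub, eval_of, eval_of, euler_witness_value_eq, sub_self]
  have h0 := (sup_le (rulesNoDomainAdd_le_ker hE) closure_stokesSquareRel_le_ker_evenEulerEval) (h _ hw)
  rw [AddMonoidHom.mem_ker, evenEulerEval_witness] at h0
  norm_num at h0

end CovDomainAdd

/-! ### A.6 Rule (1b) is NOT load-bearing: the crux is three-rule generation (survivor import) -/

/-- The kernel conjecture is the statement that `ker eval` is generated by rules (1a), (2), (3)
(rule (1b) derivable: tree `StuffleInKZ.Negative.Derived.relations_eq_closure_three_rules`).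
[cite: KontsevichZagier2001, §1.2 Conjecture 1] -/
theorem kzKernelConjecture_iff_threeRules :
    KZKernelConjecture ↔ ∀ x : FormalRep, eval x = 0 →
      x ∈ AddSubgroup.closure (domainAddRel ∪ changeOfVariablesRel ∪ newtonLeibnizRel) := by
  unfold KZKernelConjecture
  rw [Summit.KontsevichZagierPeriods.Theorems.StuffleInKZ.Negative.Derived.relations_eq_closure_three_rules]

/-- **The crux with three rules** (unconditional): `StokesGeneration` iff `ker eval` is generated by
domain additivity, change of variables and Newton–Leibniz — so an invariant refuting the crux must
kill exactly these three move sets, each of which is load-bearing (§A.3–A.5).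
[cite: KontsevichZagier2001, §1.2 Conjecture 1] -/
theorem stokesGeneration_iff_threeRules :
    StokesGeneration ↔ ∀ x : FormalRep, eval x = 0 →
      x ∈ AddSubgroup.closure (domainAddRel ∪ changeOfVariablesRel ∪ newtonLeibnizRel) :=
  stokesGeneration_iff_kernel.trans kzKernelConjecture_iff_threeRules

/-! ## §B Structure forced by the crux: purity of `relations` (attack handle) -/

/-- **Saturation.** The crux forces the target subgroup to be PURE in the free abelian group
`FormalRep`: if a non-zero multiple of `x` is generated then so is `x` (because `ℝ` is torsion-free).
Contrapositive = attack handle: a torsion class in `FormalRep ⧸ relations` (some `k • x ∈ relations`,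
`k ≠ 0`, `x ∉ relations`) refutes the crux. No such class is known; "no division by integers is a
rule" (summit docstring) makes this the one place where the `ℤ`-span reading of "pass from one
formula to another" could bite. [cite: KontsevichZagier2001, §1.2] -/
theorem saturated_of_stokesGeneration (h : StokesGeneration) {x : FormalRep} {k : ℤ} (hk : k ≠ 0)
    (hx : k • x ∈ relations ⊔ AddSubgroup.closure stokesSquareRel) :
    x ∈ relations ⊔ AddSubgroup.closure stokesSquareRel := by
  rw [sup_closure_stokesSquareRel_eq_relations] at hx ⊢
  have h0 : eval (k • x) = 0 := relations_le_ker_eval_holds hx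
  rw [map_zsmul, smul_eq_zero] at h0
  have hx0 : eval x = 0 := h0.resolve_left hk
  have := (stokesGeneration_iff_kernel.mp h) x hx0
  exact this

/-- The same handle for the summit. [cite: KontsevichZagier2001, §1.2] -/
theorem saturated_of_summit (h : _root_.KontsevichZagierPeriods) {x : FormalRep} {k : ℤ} (hk : k ≠ 0)
    (hx : k • x ∈ relations) : x ∈ relations := by
  have h' := stokesGeneration_iff_summit.mpr h
  have := saturated_of_stokesGeneration h' hk (AddSubgroup.mem_sup_left hx)
  rwa [sup_closure_stokesSquareRel_eq_relations] at this

/-! ## §D Line `Sketch` (card cube-type-a-generation) — stub attack log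

Read from `Cruxes/StokesGeneration/Lines/Sketch.lean` (lead attempt 0). Findings (cycle 1):

* JOINT SUFFICIENCY: `StokesGeneration_of` is composed from the seven stubs with no further `sorry`
  (the skeleton elaborates with exactly seven sorries — checked `lean check`, see NOTES); no gap is
  smuggled: the composition lands in `relations` and uses `AddSubgroup.mem_sup_left`, consistent with
  §0 (`⊔ closure S` redundant).
* `stub_typeAGeneration` (T): Ayoub 2015 Conj. 1.1 typed over `AyoubPeriodSeries.lean`. By §0 and the
  skeleton's own calibration it is summit-strength. Typing audit: (i) `k`-span vs `ℚ̄`/`ℂ`-span is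
  immaterial (`relAC i` is `ℂ`-linear, `Oan σ` is stable under algebraic scalars, and a `ℂ`-solution of
  a `ℚ̄`-linear system descends), so the `∀ k` with algebraic image is not an over-generalisation;
  (ii) `intC`, `restrC` are genuine (absolutely convergent) on `Oan` — no junk-`tsum` instance found;
  (iii) cannot be weakened to a bounded number of auxiliary variables:
  `Literature.Barriers.KontsevichZagierPeriods…kernelElt_not_stokes_one_variable` (tree, proved).
  Not attackable below GPC strength. No stub-false claim.
* `stub_germToOan` (D): edge case `N = 0` checked on paper (constant algebraic series, `intC = c₀ =
  ∫_{pt}`); algebraicity of the Taylor series from semialgebraicity of the sum uses the identity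
  theorem on the cube (interior non-empty) — fine. Plausible, L.
* `stub_spanToReps` (R): real parts coefficientwise preserve `Oan` (conjugate series is again
  algebraic over `ℚ̄(z)`); plausible, L.
* `stub_cubeCalibration` (C): provable now; note the semialgebraicity of `∂ᵢG` on the cube is FREE here
  (it equals `r.integrand + G|₁ − G|₀` on `r.domain`), so no Tarski–Seidenberg-for-derivatives is
  needed. `m = 0` is vacuous (`i : Fin 0`).
* `stub_cubeNashNormalForm` (N₁), `stub_nashToGerm` (N₂), `stub_mergeCubes`: existence statements
  modulo `relations`; only `eval` separates, and at the level of values they are Ayoub/HMS normal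
  forms — no invariant of §A bites (all of them use rule 3) legitimately). Not refutable cheaply.
-/

end Summit.KontsevichZagierPeriods.KontsevichZagierPeriods.Cruxes.StokesGeneration.Disproof
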